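import Mathlib
import Summits.ResolutionOfSingularities.ResolutionOfSingularities.Theorems.WeightedInvariantLocalWeightedDropNCResSurfGraphIdeal

/-!
# `WeightedInvariant.LocalWeightedDrop`: NC-resolution settings for the TOT₂ line — GRAPH SURFACES, part 12: SHEAR ADDITIVITY and the graph surface
# IN THE PARTIALLY SHEARED COORDINATES (the datum of the curve move)

Crux item stmt-ResolutionOfSingularities-8899 `LocalWeightedDrop` (route `ResolutionOfSingularities/WeightedInvariant`), ENGINE skeleton v32/v33, residuals
`stub_spaceNCRankDrop` / `stub_wildWideApexFourStartsWon` (res-L1-w43-strat-1's line `directrix-cut` v3.1, piece PL = `ApexPlaneExit`, SURFACE sub-case;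
design memo `L/res-L1-w43-stub-4/g5/S-E2-SURF.md` §6).  [OURS · L1 W4.3 · chain w43 · seat res-L1-w43-stub-4 gen 5; def-free on parts 1–2; the count
game is the programme's own; nothing here is a statement of any manuscript; AI-produced, gate-checked, weaker than expert review.]

* **`subst_shear_shear`**, `subst_shear_subst_shear` — SHEAR ADDITIVITY: `shear(ψ₁)^* ∘ shear(ψ₂)^* = shear(ψ₁ + ψ₂)^*` (generalises part 1's
  `subst_shear_shear_neg`);
* **`inOffPlaneIdeal_partialShear`** — splitting `ψ = ψ^E + ψ̂` (`ψ^E = ψ` on `E`, `0` off `E`; `ψ̂` the other way round): the germ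
  `ĝ = Φ̂^* g = shear(ψ̂)^* g` of the partially sheared coordinates is permissible along the graph surface `(a, b, ψ^E)`:
  `shear(ψ^E)^* ĝ = shear(ψ)^* g ∈ (x_j : j ∉ {a,b})^c`.  This is the graph datum on which the curve move of parts 10–11 operates.
-/

set_option linter.dupNamespace false -- mandated namespace of this single-conjunct summit

noncomputable section

namespace Summit.ResolutionOfSingularities.ResolutionOfSingularities.Theorems

namespace TameFourTupleDrop

namespace GraphSurf

open MvPowerSeries Literature.AlgebraicGeometry.Resolution

variable {k : Type} [Field k] {m : ℕ}

/-- **SHEAR ADDITIVITY**: substituting `shear(ψ₂)` and then `shear(ψ₁)` is substituting `shear(ψ₁ + ψ₂)`, componentwise. -/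
theorem subst_shear_shear {a b : Fin (m + 1)} {ψ₁ : Fin (m + 1) → MvPowerSeries (Fin 2) k}
    (hψ₁ : ∀ j, ¬ (j = a ∨ j = b) → constantCoeff (ψ₁ j) = 0) (ψ₂ : Fin (m + 1) → MvPowerSeries (Fin 2) k) (j : Fin (m + 1)) :
    subst (shear a b ψ₁) (shear a b ψ₂ j) = shear a b (ψ₁ + ψ₂) j := by
  have hs := hasSubst_shear hψ₁
  by_cases h : j = a ∨ j = b
  · rw [shear_of_base h, subst_X hs, shear_of_base h, shear_of_base h]
  · rw [shear_of_ne h, ← coe_substAlgHom hs, map_add, coe_substAlgHom, subst_X hs, shear_of_ne h, subst_shear_onPlane hψ₁, shear_of_ne h,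
      Pi.add_apply, onPlane_add]
    ring

/-- Shear additivity on germs: `shear(ψ₁)^* (shear(ψ₂)^* G)`… precisely `subst (shear ψ₁) (subst (shear ψ₂) G) = subst (shear (ψ₁ + ψ₂)) G`. -/
theorem subst_shear_subst_shear {a b : Fin (m + 1)} {ψ₁ ψ₂ : Fin (m + 1) → MvPowerSeries (Fin 2) k}
    (hψ₁ : ∀ j, ¬ (j = a ∨ j = b) → constantCoeff (ψ₁ j) = 0) (hψ₂ : ∀ j, ¬ (j = a ∨ j = b) → constantCoeff (ψ₂ j) = 0)
    (G : MvPowerSeries (Fin (m + 1)) k) : subst (shear a b ψ₁) (subst (shear a b ψ₂) G) = subst (shear a b (ψ₁ + ψ₂)) G := by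
  rw [subst_comp_subst_apply (hasSubst_shear hψ₂) (hasSubst_shear hψ₁)]
  congr 1
  funext j
  exact subst_shear_shear hψ₁ ψ₂ j

/-- **THE GRAPH SURFACE IN THE PARTIALLY SHEARED COORDINATES.**  With `ψ̂ = 0` on `E`, `ψ` off `E` and `ψ^E = ψ` on `E`, `0` off `E`:
if `(a, b, ψ)` is permissible at order `c` for `g` then `(a, b, ψ^E)` is permissible at order `c` for `ĝ = shear(ψ̂)^* g`. -/
theorem inOffPlaneIdeal_partialShear {a b : Fin (m + 1)} {ψ : Fin (m + 1) → MvPowerSeries (Fin 2) k}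
    (hψ : ∀ j, ¬ (j = a ∨ j = b) → constantCoeff (ψ j) = 0) (E : Finset (Fin (m + 1))) {c : ℕ} {g : MvPowerSeries (Fin (m + 1)) k}
    (hperm : InOffPlaneIdeal a b c (subst (shear a b ψ) g)) :
    InOffPlaneIdeal a b c (subst (shear a b (fun j => if j ∈ E then ψ j else 0)) (subst (shear a b (fun j => if j ∈ E then 0 else ψ j)) g)) := by
  classical
  have h1 : ∀ j, ¬ (j = a ∨ j = b) → constantCoeff ((fun j => if j ∈ E then ψ j else 0) j) = 0 := fun j hj => by
    simp only
    split_ifs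
    · exact hψ j hj
    · exact map_zero _
  have h2 : ∀ j, ¬ (j = a ∨ j = b) → constantCoeff ((fun j => if j ∈ E then 0 else ψ j) j) = 0 := fun j hj => by
    simp only
    split_ifs
    · exact map_zero _
    · exact hψ j hj
  have hsum : ((fun j => if j ∈ E then ψ j else 0) + fun j => if j ∈ E then 0 else ψ j) = ψ := by
    funext j
    simp only [Pi.add_apply]
    split_ifs <;> simp
  rw [subst_shear_subst_shear h1 h2, hsum]
  exact hperm

/-- The datum `ψ^E` has traces divisible by `u₁` on the off-base letters of `E` when `ψ` does (bookkeeping for parts 10–11). -/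
theorem X_zero_dvd_restrict {a b : Fin (m + 1)} {ψ : Fin (m + 1) → MvPowerSeries (Fin 2) k} (E : Finset (Fin (m + 1)))
    (hE : ∀ l ∈ E, ¬ (l = a ∨ l = b) → (X 0 : MvPowerSeries (Fin 2) k) ∣ ψ l) :
    ∀ l ∈ E, ¬ (l = a ∨ l = b) → (X 0 : MvPowerSeries (Fin 2) k) ∣ (fun j => if j ∈ E then ψ j else 0) l := fun l hl hlab => by
  simp only [if_pos hl]
  exact hE l hl hlab

end GraphSurf

end TameFourTupleDrop

end Summit.ResolutionOfSingularities.ResolutionOfSingularities.Theorems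

end
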